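import Summits.AtomisticToContinuum.Crystallization.Theorems.FrustratedLawDichotomyStrainedPatchWindowTaylorSplit
import Summits.AtomisticToContinuum.Crystallization.Theorems.FrustratedLawDichotomyStrainedPatchTaylorChordSigned

/-!
# (P2a⁻) The pair chord lemma and the matched second-order inequality with a GENERAL band table `K` (lens-5 g56, crux 27623 T-side, T2⁻)

The tree chain `KbandCert → PairChord → MatchedTaylorW → TaylorTwoBentW` (`…TaylorLeaves`, `…TaylorPair`, `…WindowTaylorSplit`) hard-wires the
two-sided table `Kband` into the quadratic penalty `quadTerm w₀`.  This file re-runs it with the table as a PARAMETER `K : ℝ → ℝ` and with the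
ONE-SIDED certificate `KbandCertSigned K` (`−K r ≤ W″(s)`, `−K r·s ≤ W′(s)` on the band of `r`) as input — a LOWER chord bound only ever needs LOWER
curvature bounds (`…TaylorChordSigned.chordC11Signed_holds`):
§1 `KbandCertSigned K`, `PairChordWith K` (`= PairChord` at `K = Kband`), ★ `pairChordWith_of_signed : (K ≥ 0) → WrecC1 → KbandCertSigned K → PairChordWith K`;
§2 the weight table `wOf K` (`w₀ = wOf Kband` by `rfl`), its monotonicity in `K`, `quadTerm` re-based on the image set (`quadTerm_eqW_with`);
§3 `MatchedTaylorWWith K` ⟸ `PairChordWith K` (tree `matchedTaylor_of_pairChordW` verbatim with `Kband ↦ K`);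
§4 the seam ★★ `smoothTaylorTwoW_of_signedCert : (K ≥ 0) → KbandCertSigned K → BeyondBallTailW → SmoothTaylorTwo CompFamilyW tau1 delta0 G0 (wOf K) rho0`
(pieces (P1), (P2b), (P3a) are the tree's `scoreLeMatched_bentW`, `gradientSplit_bentW`, `matchedIsFrozenInBall_bentW`; (R) is `wrecC1_holds`), and
`smoothTaylorTwo_mono_w` (a larger table is a weaker statement).  Instantiated at the census table `KbandMinus` in `…TaylorKbandMinus`.  0 sorry.
-/

open scoped BigOperators Classical
open Summit.AtomisticToContinuum.Crystallization.Theorems.FrustratedLawDichotomyRangeCut (Sep)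
open Summit.AtomisticToContinuum.Crystallization.Theorems.FrustratedLawDichotomyMotifLemmas
open Summit.AtomisticToContinuum.Crystallization.Theorems.FrustratedLawDichotomyAveragingCut
open Summit.AtomisticToContinuum.Crystallization.Theorems.FrustratedLawDichotomyAveragingRuleCap
open Summit.AtomisticToContinuum.Crystallization.Theorems.FrustratedLawDichotomyAveragingRuleTightFree
open Summit.AtomisticToContinuum.Crystallization.Theorems.FrustratedLawDichotomyExemptAbsorptionRecord
open Summit.AtomisticToContinuum.Crystallization.Theorems.FrustratedLawDichotomySchurCut
open Literature.MathematicalPhysics.StatisticalMechanics (lennardJones lennardJones_nonpos)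
open Summit.AtomisticToContinuum.Crystallization.Theorems.FrustratedLawDichotomyRuleToolkitGood
open Summit.AtomisticToContinuum.Crystallization.Theorems.FrustratedLawDichotomyStrainedPatchHomSplit
open Summit.AtomisticToContinuum.Crystallization.Theorems.FrustratedLawDichotomyStrainedPatchHomTermCalculus
open Summit.AtomisticToContinuum.Crystallization.Theorems.FrustratedLawDichotomyStrainedPatchChartFamilies
open Summit.AtomisticToContinuum.Crystallization.Theorems.FrustratedLawDichotomyStrainedPatchChartFamiliesBent
open Summit.AtomisticToContinuum.Crystallization.Theorems.FrustratedLawDichotomyStrainedPatchChartFamiliesPinned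
open Summit.AtomisticToContinuum.Crystallization.Theorems.FrustratedLawDichotomyStrainedPatchEnvelopeLaw
open Summit.AtomisticToContinuum.Crystallization.Theorems.FrustratedLawDichotomyStrainedPatchEnvelopeTaylor
open Summit.AtomisticToContinuum.Crystallization.Theorems.FrustratedLawDichotomyStrainedPatchTaylorSplit
open Summit.AtomisticToContinuum.Crystallization.Theorems.FrustratedLawDichotomyStrainedPatchTaylorPair
open Summit.AtomisticToContinuum.Crystallization.Theorems.FrustratedLawDichotomyStrainedPatchTaylorChord
open Summit.AtomisticToContinuum.Crystallization.Theorems.FrustratedLawDichotomyStrainedPatchTaylorLeaves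
open Summit.AtomisticToContinuum.Crystallization.Theorems.FrustratedLawDichotomyStrainedPatchTaylorRegular
open Summit.AtomisticToContinuum.Crystallization.Theorems.FrustratedLawDichotomyStrainedPatchRecutPairs
open Summit.AtomisticToContinuum.Crystallization.Theorems.FrustratedLawDichotomyStrainedPatchRecutKinematics
open Summit.AtomisticToContinuum.Crystallization.Theorems.FrustratedLawDichotomyStrainedPatchWindowFamilies
open Summit.AtomisticToContinuum.Crystallization.Theorems.FrustratedLawDichotomyStrainedPatchWindowTaylorSplit
open Summit.AtomisticToContinuum.Crystallization.Theorems.FrustratedLawDichotomyStrainedPatchTaylorChordSigned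

namespace Summit.AtomisticToContinuum.Crystallization.Theorems.FrustratedLawDichotomyStrainedPatchTaylorPairSigned

/-! ## §1. The signed certificate and the pair chord lemma for a general table `K` -/

/-- **(N⁻ K) `KbandCertSigned K`** [CERTIFIED NUMERICS · one-sided] — on the `s`-range `[chordLo r, r + 1/10]` of the band of `r ≥ 7/10`, off the junction
radii: `−K r ≤ W₄₅″(s)` and `−K r · s ≤ W₄₅′(s)`. -/
def KbandCertSigned (K : ℝ → ℝ) : Prop :=
  ∀ r s : ℝ, 7 / 10 ≤ r → chordLo r ≤ s → s ≤ r + 1 / 10 → s ∉ junctions → -K r ≤ deriv (deriv Wrec) s ∧ -(K r * s) ≤ deriv Wrec s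

/-- **(P2a-core K) `PairChordWith K`** — the pair chord inequality `W‖p‖ + DW(p)·Δ − ½K(‖p‖)‖Δ‖² ≤ W‖p + Δ‖` for partners at `‖p‖, ‖p+Δ‖ ≥ 7/10`, `‖Δ‖ ≤ 1/10`. -/
def PairChordWith (K : ℝ → ℝ) : Prop :=
  ∀ p Δ : E3, 7 / 10 ≤ ‖p‖ → 7 / 10 ≤ ‖p + Δ‖ → ‖Δ‖ ≤ 1 / 10 → radW p + radD p Δ - K ‖p‖ / 2 * ‖Δ‖ ^ 2 ≤ radW (p + Δ)

/-- At `K = Kband` this is the tree's `PairChord`. [formal bookkeeping] -/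
theorem pairChordWith_kband_iff : PairChordWith Kband ↔ PairChord := Iff.rfl

/-- A two-sided tree certificate gives the signed one. [formal bookkeeping] -/
theorem kbandCertSigned_of_kbandCert (h : KbandCert) : KbandCertSigned Kband :=
  fun r s hr h1 h2 hJ => ⟨(abs_le.1 (h r s hr h1 h2 hJ).1).1, (abs_le.1 (h r s hr h1 h2 hJ).2).1⟩

/-- ★★ **(P2a-core K) ⟸ (C⁻) ∧ (R) ∧ (N⁻ K)**: instantiate the one-sided chord lemma with `W = W₄₅`, `W₁ = W₄₅′`, `J = junctions`, `K = K‖p‖`,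
`[a, b] = [chordLo‖p‖, ‖p‖ + 1/10]` (tree `pairChord_of_pieces` verbatim on `chordC11Signed_holds`). [folklore] -/
theorem pairChordWith_of_signed {K : ℝ → ℝ} (hK0 : ∀ r, 0 ≤ K r) (hR : WrecC1) (hK : KbandCertSigned K) : PairChordWith K := by
  intro p Δ h1 h2 h3
  have ha := chordLo_pos ‖p‖
  have hW : ∀ r, chordLo ‖p‖ ≤ r → r ≤ ‖p‖ + 1 / 10 → HasDerivAt Wrec (deriv Wrec r) r := fun r hr _ =>
    (differentiableAt_Wrec (ha.trans_le hr).ne').hasDerivAt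
  have hcont : ContinuousOn (deriv Wrec) (Set.Icc (chordLo ‖p‖) (‖p‖ + 1 / 10)) := hR.1.mono fun r hr => ha.trans_le hr.1
  have hgood : ∀ r, chordLo ‖p‖ < r → r < ‖p‖ + 1 / 10 → r ∉ junctions →
      HasDerivAt (deriv Wrec) (deriv (deriv Wrec) r) r ∧ -K ‖p‖ ≤ deriv (deriv Wrec) r ∧ -(K ‖p‖ * r) ≤ deriv Wrec r :=
    fun r hr1 hr2 hJ => ⟨(hR.2 r (ha.trans hr1) hJ).hasDerivAt, hK ‖p‖ r h1 hr1.le hr2.le hJ⟩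
  exact chordC11Signed_holds Wrec (deriv Wrec) junctions (K ‖p‖) (chordLo ‖p‖) (‖p‖ + 1 / 10) p Δ ha (hK0 _) hW hcont hgood
    (fun s hs => chord_tube h1 h2 h3 hs)

/-- (P2a-core K) from the signed certificate alone ((C⁻) and (R) are theorems). [folklore] -/
theorem pairChordWith_of_signedCert {K : ℝ → ℝ} (hK0 : ∀ r, 0 ≤ K r) (hK : KbandCertSigned K) : PairChordWith K :=
  pairChordWith_of_signed hK0 wrecC1_holds hK

/-! ## §2. The weight table `wOf K` -/

/-- The quadratic-penalty weight table of a band function `K`: `K(r_{bb'})/(4·#B(b))` for members `b`, `0` otherwise. -/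
noncomputable def wOf (K : ℝ → ℝ) : (M₁ : ℕ) → (Fin M₁ → E3) → Fin M₁ → Fin M₁ → Fin M₁ → ℝ :=
  fun _ z₁ c₁ b b' => if b ∈ ball (9 / 5) z₁ c₁ then K (dist (z₁ b) (z₁ b')) / (4 * ((ball (9 / 5) z₁ b).card : ℝ)) else 0

/-- The tree's `w₀` is `wOf Kband`. [formal bookkeeping] -/
theorem w0_eq_wOf : w0 = wOf Kband := rfl

/-- `wOf` is monotone in the table. [formal bookkeeping] -/
theorem wOf_mono {K K' : ℝ → ℝ} (h : ∀ r, K r ≤ K' r) (M₁ : ℕ) (z₁ : Fin M₁ → E3) (c₁ b b' : Fin M₁) : wOf K M₁ z₁ c₁ b b' ≤ wOf K' M₁ z₁ c₁ b b' := by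
  simp only [wOf]
  split_ifs with hb
  · exact div_le_div_of_nonneg_right (h _) (by positivity)
  · exact le_rfl

/-- `wOf K ≥ 0` for `K ≥ 0`. [formal bookkeeping] -/
theorem wOf_nonneg {K : ℝ → ℝ} (h : ∀ r, 0 ≤ K r) (M₁ : ℕ) (z₁ : Fin M₁ → E3) (c₁ b b' : Fin M₁) : 0 ≤ wOf K M₁ z₁ c₁ b b' := by
  simp only [wOf]
  split_ifs
  · exact div_nonneg (h _) (by positivity)
  · exact le_rfl

/-- `quadTerm` is monotone in the weight table. [formal bookkeeping] -/
theorem quadTerm_mono {w w' : (M₁ : ℕ) → (Fin M₁ → E3) → Fin M₁ → Fin M₁ → Fin M₁ → ℝ} (h : ∀ M₁ z₁ c₁ b b', w M₁ z₁ c₁ b b' ≤ w' M₁ z₁ c₁ b b')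
    {M : ℕ} (z : Fin M → E3) (c : Fin M) {M₁ : ℕ} (z₁ : Fin M₁ → E3) (c₁ : Fin M₁) (e : Fin M → Fin M₁) :
    quadTerm w z c z₁ c₁ e ≤ quadTerm w' z c z₁ c₁ e :=
  Finset.sum_le_sum fun _ _ => Finset.sum_le_sum fun _ _ => mul_le_mul_of_nonneg_right (h _ _ _ _ _) (sq_nonneg _)

/-- ★ A LARGER weight table is a WEAKER second-order inequality. [formal bookkeeping] -/
theorem smoothTaylorTwo_mono_w {𝓘 : (M₀ : ℕ) → (Fin M₀ → E3) → Fin M₀ → Prop} {τ δ : ℝ} {G : (M₁ : ℕ) → (Fin M₁ → E3) → Fin M₁ → Fin M₁ → (E3 →L[ℝ] ℝ)}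
    {w w' : (M₁ : ℕ) → (Fin M₁ → E3) → Fin M₁ → Fin M₁ → Fin M₁ → ℝ} {ϱ : (M₁ : ℕ) → (Fin M₁ → E3) → Fin M₁ → ℝ}
    (h : ∀ M₁ z₁ c₁ b b', w M₁ z₁ c₁ b b' ≤ w' M₁ z₁ c₁ b b') (hT : SmoothTaylorTwo 𝓘 τ δ G w ϱ) : SmoothTaylorTwo 𝓘 τ δ G w' ϱ := by
  intro M z c M₁ z₁ c₁ e t hz hch hf
  have h1 := hT M z c M₁ z₁ c₁ e t hz hch hf
  have h2 := quadTerm_mono h z c z₁ c₁ e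
  linarith

/-- `quad_{wOf K}(dev)` as the explicit pair sum `Σ_j Σ_{k ∈ S} K(r_jk)/(4#B j)·‖d_j − d_k‖²` (tree `quadTerm_eqW` verbatim with `Kband ↦ K`). [formal bookkeeping] -/
theorem quadTerm_eqW_with (K : ℝ → ℝ) {t : ℝ} {M : ℕ} {z : Fin M → E3} {c : Fin M} {M₁ : ℕ} {z₁ : Fin M₁ → E3} {c₁ : Fin M₁} {e : Fin M → Fin M₁}
    (hch : ChartBy CompFamilyW tau1 t z c z₁ c₁ e) :
    quadTerm (wOf K) z c z₁ c₁ e = ∑ j ∈ ball (9 / 5) z₁ c₁, ∑ k ∈ images z c e,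
      K (dist (z₁ j) (z₁ k)) / (4 * ((ball (9 / 5) z₁ j).card : ℝ)) * ‖shiftField z c z₁ c₁ e j - shiftField z c z₁ c₁ e k‖ ^ 2 := by
  have hinj : Set.InjOn e (ball (63 / 10) z c : Finset (Fin M)) := fun b hb b' hb' h =>
    hch.2.2.2.2.1 b b' (mem_ball.1 (Finset.mem_coe.1 hb)) (mem_ball.1 (Finset.mem_coe.1 hb')) h
  have h1 : quadTerm (wOf K) z c z₁ c₁ e = ∑ b ∈ images z c e, ∑ b' ∈ images z c e,
      wOf K M₁ z₁ c₁ b b' * ‖shiftField z c z₁ c₁ e b - shiftField z c z₁ c₁ e b'‖ ^ 2 := by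
    unfold quadTerm images
    rw [Finset.sum_image hinj]
    refine Finset.sum_congr rfl fun a ha => ?_
    rw [Finset.sum_image hinj]
    exact Finset.sum_congr rfl fun a' ha' => by rw [shiftField_imageW hch ha, shiftField_imageW hch ha']
  rw [h1]
  have h2 : ∀ b ∈ images z c e, ∑ b' ∈ images z c e, wOf K M₁ z₁ c₁ b b' * ‖shiftField z c z₁ c₁ e b - shiftField z c z₁ c₁ e b'‖ ^ 2
      = if b ∈ ball (9 / 5) z₁ c₁ then ∑ b' ∈ images z c e,
          K (dist (z₁ b) (z₁ b')) / (4 * ((ball (9 / 5) z₁ b).card : ℝ)) * ‖shiftField z c z₁ c₁ e b - shiftField z c z₁ c₁ e b'‖ ^ 2 else 0 := by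
    intro b _
    split_ifs with hb
    · exact Finset.sum_congr rfl fun b' _ => by simp only [wOf, if_pos hb]
    · exact Finset.sum_eq_zero fun b' _ => by simp only [wOf, if_neg hb, zero_mul]
  rw [Finset.sum_congr rfl h2, Finset.sum_ite_mem, Finset.inter_eq_right.2 (ball_subset_imagesW hch)]

/-! ## §3. (P2a K): the matched second-order inequality with penalty `quad_{wOf K}` -/

/-- **(P2a K) `MatchedTaylorWWith K`** — `F_S(z₁) + G_S·dev − quad_{wOf K}(dev) ≤ F_S(moved)` in the W frame. -/
def MatchedTaylorWWith (K : ℝ → ℝ) : Prop :=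
  FrameW fun _ z c _ z₁ c₁ e => matchScore (images z c e) z₁ c₁ z₁ + linMatch z c z₁ c₁ e - quadTerm (wOf K) z c z₁ c₁ e
    ≤ matchScore (images z c e) z₁ c₁ (moved z c z₁ c₁ e)

/-- At `K = Kband` this is the tree's `MatchedTaylorW`. [formal bookkeeping] -/
theorem matchedTaylorWWith_kband_iff : MatchedTaylorWWith Kband ↔ MatchedTaylorW := Iff.rfl

/-- ★★ **(P2a K) ⟸ (P2a-core K)** — sum the pair inequalities with weights `(#B j)⁻¹·½ ≥ 0` (tree `matchedTaylor_of_pairChordW` verbatim, `Kband ↦ K`). [folklore] -/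
theorem matchedTaylorW_of_pairChordWith {K : ℝ → ℝ} (hPC : PairChordWith K) : MatchedTaylorWWith K := by
  intro M z c M₁ z₁ c₁ e t hz hch hf
  have hsepz : Sep z := hz.2.1
  have hsep1 : Sep z₁ := hch.1.2.1
  have hBS := ball_subset_imagesW hch
  have pair : ∀ j ∈ ball (9 / 5) z₁ c₁, ∀ k ∈ images z c e,
      (((ball (9 / 5) z₁ j).card : ℝ))⁻¹ * (2⁻¹ * (if j = k then 0 else radD (z₁ j - z₁ k) (shiftField z c z₁ c₁ e j - shiftField z c z₁ c₁ e k)))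
        - K (dist (z₁ j) (z₁ k)) / (4 * ((ball (9 / 5) z₁ j).card : ℝ)) * ‖shiftField z c z₁ c₁ e j - shiftField z c z₁ c₁ e k‖ ^ 2
      ≤ (((ball (9 / 5) z₁ j).card : ℝ))⁻¹ * (2⁻¹ * (Wrec (dist (moved z c z₁ c₁ e j) (moved z c z₁ c₁ e k)) - Wrec (dist (z₁ j) (z₁ k)))) := by
    intro j hj k hk
    have hc : (0 : ℝ) ≤ (((ball (9 / 5) z₁ j).card : ℝ))⁻¹ * 2⁻¹ := by positivity
    have core : (if j = k then 0 else radD (z₁ j - z₁ k) (shiftField z c z₁ c₁ e j - shiftField z c z₁ c₁ e k))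
        - K (dist (z₁ j) (z₁ k)) / 2 * ‖shiftField z c z₁ c₁ e j - shiftField z c z₁ c₁ e k‖ ^ 2
        ≤ Wrec (dist (moved z c z₁ c₁ e j) (moved z c z₁ c₁ e k)) - Wrec (dist (z₁ j) (z₁ k)) := by
      by_cases hjk : j = k
      · subst hjk
        simp
      · rw [if_neg hjk]
        obtain ⟨a, ha, rfl⟩ := Finset.mem_image.1 (hBS hj)
        obtain ⟨a', ha', rfl⟩ := Finset.mem_image.1 hk
        have haa' : a ≠ a' := fun h => hjk (by rw [h])
        have h1 : 7 / 10 ≤ ‖z₁ (e a) - z₁ (e a')‖ := by rw [← dist_eq_norm]; exact hsep1 _ _ hjk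
        have h2 : 7 / 10 ≤ ‖(z₁ (e a) - z₁ (e a')) + (shiftField z c z₁ c₁ e (e a) - shiftField z c z₁ c₁ e (e a'))‖ := by
          rw [← moved_sub_moved, ← dist_eq_norm, dist_moved_imageW hch ha ha']
          exact hsepz a a' haa'
        have h3 : ‖shiftField z c z₁ c₁ e (e a) - shiftField z c z₁ c₁ e (e a')‖ ≤ 1 / 10 := by
          rw [shiftField_imageW hch ha, shiftField_imageW hch ha']
          have := hf a (mem_ball.1 ha)
          have := hf a' (mem_ball.1 ha')
          rw [delta0] at *
          linarith [norm_sub_le (dev z c z₁ c₁ e a) (dev z c z₁ c₁ e a')]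
        have h := hPC _ _ h1 h2 h3
        simp only [radW] at h
        rw [← dist_eq_norm (z₁ (e a)) (z₁ (e a')), ← moved_sub_moved, ← dist_eq_norm (moved z c z₁ c₁ e (e a)) (moved z c z₁ c₁ e (e a'))] at h
        linarith
    have h := mul_le_mul_of_nonneg_left core hc
    have e1 : (((ball (9 / 5) z₁ j).card : ℝ))⁻¹ * 2⁻¹ * ((if j = k then 0 else radD (z₁ j - z₁ k) (shiftField z c z₁ c₁ e j - shiftField z c z₁ c₁ e k))
        - K (dist (z₁ j) (z₁ k)) / 2 * ‖shiftField z c z₁ c₁ e j - shiftField z c z₁ c₁ e k‖ ^ 2)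
        = (((ball (9 / 5) z₁ j).card : ℝ))⁻¹ * (2⁻¹ * (if j = k then 0 else radD (z₁ j - z₁ k) (shiftField z c z₁ c₁ e j - shiftField z c z₁ c₁ e k)))
        - K (dist (z₁ j) (z₁ k)) / (4 * ((ball (9 / 5) z₁ j).card : ℝ)) * ‖shiftField z c z₁ c₁ e j - shiftField z c z₁ c₁ e k‖ ^ 2 := by
      ring
    rw [e1] at h
    linarith
  have hsum := Finset.sum_le_sum fun j hj => Finset.sum_le_sum fun k hk => pair j hj k hk
  simp only [Finset.sum_sub_distrib] at hsum
  rw [← linMatch_eqW hch, ← quadTerm_eqW_with K hch, ← matchScore_sub] at hsum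
  linarith

/-! ## §4. The seam to `SmoothTaylorTwo CompFamilyW tau1 delta0 G0 (wOf K) rho0` -/

/-- ★★ THE SEAM: (P2a K) ∧ (P3b) ⟹ `SmoothTaylorTwo 𝓘₁ʷ τ₁ δ₀ G₀ (wOf K) ϱ₀` ((P1), (P2b), (P3a) are the tree theorems `scoreLeMatched_bentW`,
`gradientSplit_bentW`, `matchedIsFrozenInBall_bentW`; tree `taylorTwoBentW_of_pieces` verbatim). [folklore] -/
theorem smoothTaylorTwoW_of_piecesWith {K : ℝ → ℝ} (h2a : MatchedTaylorWWith K) (h3b : BeyondBallTailW) :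
    SmoothTaylorTwo CompFamilyW tau1 delta0 G0 (wOf K) rho0 := by
  intro M z c M₁ z₁ c₁ e t hz hch hf
  have h1 := scoreLeMatched_bentW M z c M₁ z₁ c₁ e t hz hch hf
  have h₂ := h2a M z c M₁ z₁ c₁ e t hz hch hf
  have h₃ := gradientSplit_bentW M z c M₁ z₁ c₁ e t hz hch hf
  have h₄ := matchedIsFrozenInBall_bentW M z c M₁ z₁ c₁ e t hz hch hf
  have h₅ := h3b M z c M₁ z₁ c₁ e t hz hch hf
  rw [rho0_eq]
  linarith

/-- ★★ (P2a-core K) ∧ (P3b) ⟹ `SmoothTaylorTwo 𝓘₁ʷ τ₁ δ₀ G₀ (wOf K) ϱ₀`. [folklore] -/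
theorem smoothTaylorTwoW_of_pairChordWith {K : ℝ → ℝ} (h2 : PairChordWith K) (h3b : BeyondBallTailW) :
    SmoothTaylorTwo CompFamilyW tau1 delta0 G0 (wOf K) rho0 :=
  smoothTaylorTwoW_of_piecesWith (matchedTaylorW_of_pairChordWith h2) h3b

/-- ★★★ THE SIGNED-CERTIFICATE SEAM: `K ≥ 0` ∧ (N⁻ K) ∧ (P3b) ⟹ `SmoothTaylorTwo 𝓘₁ʷ τ₁ δ₀ G₀ (wOf K) ϱ₀` ((C⁻) and (R) are theorems). [folklore] -/
theorem smoothTaylorTwoW_of_signedCert {K : ℝ → ℝ} (hK0 : ∀ r, 0 ≤ K r) (hK : KbandCertSigned K) (h3b : BeyondBallTailW) :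
    SmoothTaylorTwo CompFamilyW tau1 delta0 G0 (wOf K) rho0 :=
  smoothTaylorTwoW_of_pairChordWith (pairChordWith_of_signedCert hK0 hK) h3b

/-- Sanity: at `K = Kband` the seam returns the tree node `TaylorTwoBentW` from the tree leaves. [formal bookkeeping] -/
theorem taylorTwoBentW_of_signedKband (hK : KbandCert) (h3b : BeyondBallTailW) : TaylorTwoBentW :=
  smoothTaylorTwoW_of_signedCert Kband_nonneg (kbandCertSigned_of_kbandCert hK) h3b

end Summit.AtomisticToContinuum.Crystallization.Theorems.FrustratedLawDichotomyStrainedPatchTaylorPairSigned
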